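import Mathlib.Tactic
import Summits.KontsevichZagierPeriods.Zeta5Search.SymmetricFamilyInnerSum
import Summits.KontsevichZagierPeriods.Zeta5Search.Certificates.Telescoping
import HarnessLib

/-!
# ζ(5) search — brown9 LEVEL 1: the inner block `T(n;p,q)` of the "vanishing in the middle" sum is a rank-2 module (replayed certificates) (cell `pub-zeta5`, certifier `cert-1`)

HONEST FRAMING: systematic search; no irrationality claim unless certified.

The leading coefficient `A(n)` of Brown–Zudilin's generalised "vanishing in the middle" integrals on `M_{0,10}`
(`Cells/VanishingMiddleLeading.lean`, fam-brown9) is a 6-fold binomial sum each of whose innermost sums is an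
instance of
  `T(n;p,q) = Σ_k (−1)^k C(n,k) C(p−k,n) C(q−k,n)`,  `C(x,n) := x(x−1)⋯(x−n+1)/n!` (POLYNOMIAL convention),
a terminating `₃F₂`-type sum that is neither Gosper-summable nor first-order in `p` (ttrl2 lane `zeta5-calc`,
request `zeta5-brown9-vim`, `run/shared/lean/ttrl/zeta5-calc/brown9/VIM.md` §2 (b1)). The lane FOUND and verified
(sympy `cancel`, an independent flint verifier, 1520 exact rows; tamper control) creative-telescoping certificates
making `T` a RANK-2 holonomic module; this file REPLAYS three of them in the kernel through `Certificates/Telescoping`: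

* (P2) `T_rel_P2` — order 2 in `p` (`n ≥ 2`): `(p+1−n)(n+p−q+1)·T(p) + σ₁·T(p+1) + (p+2−n)(p−q+1−n)·T(p+2) = 0`,
  `σ₁ = n²+2np−2nq+3n−2p²+2pq−5p+3q−3`; certificate `G(k) = (−1)^k k(q+1−k) C(n,k) C(p+1−k,n−1) C(q−k,n)`;
* (M3) `T_rel_M3` — mixed three-term contiguity (`n ≥ 1`):
  `(p−q)(p+q+2−2n)·T(p,q) − (p+1−n)(p−q−n)·T(p+1,q) − (q+1−n)(n+p−q)·T(p,q+1) = 0`,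
  certificate `G(k) = (−1)^k k(p−q) C(n,k) C(p+1−k,n) C(q+1−k,n)`;
* (M4) `T_rel_M4` — the summand's own four-term relation summed (zero certificate, `n ≥ 1`):
  `(p−q)·T(p,q) + (n−p+q)·T(p+1,q) − (n+p−q)·T(p,q+1) + (p−q)·T(p+1,q+1) = 0`.
The `n`-shift (N1) is `Certificates/VIMInnerModuleN.lean`. `p, q` are RATIONAL parameters (the relations are polynomial
identities in `p, q`); `C(x,n)` is `bp n x = fallProd n x / n!`. Replay pattern (CERTIFY-HOWTO §10.1): unit
`(−1)^k C(n,k)·fallProd·fallProd`, cleared identity by `ring`, `telescope₃_eq_zero`/`telescope₄_eq_zero`.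
Second implementation in the seat: `HOME/cert-1/brown9/tmodule_check.py` (7164 summed instances exact, 4 cleared
identities by sympy). These are the level-1 inputs of the lane's level-2/3 certificates for `A(n)` (VIM.md §4, §7).
-/

namespace Summit.KontsevichZagierPeriods.Zeta5Search.Certificates

namespace VIMInner

open Finset
open Summit.KontsevichZagierPeriods.Zeta5Search.SymmetricRecursion (choose_succ_left_cast choose_succ_right_cast)

/-! ### Falling products and the polynomial binomial `C(x,n)` -/

/-- The falling product `x(x−1)⋯(x−m+1)`. -/
def fallProd (m : ℕ) (x : ℚ) : ℚ := ∏ i ∈ range m, (x - i)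

/-- `fallProd (m+1) x = fallProd m x · (x − m)`. -/
theorem fallProd_succ (m : ℕ) (x : ℚ) : fallProd (m + 1) x = fallProd m x * (x - m) := by
  unfold fallProd; rw [prod_range_succ]

/-- `fallProd (m+1) (x+1) = (x+1) · fallProd m x`. -/
theorem fallProd_succ_shift (m : ℕ) (x : ℚ) : fallProd (m + 1) (x + 1) = (x + 1) * fallProd m x := by
  unfold fallProd
  rw [prod_range_succ', mul_comm]
  congr 1
  · simp
  · exact prod_congr rfl fun i _ => by push_cast; ring

/-- `fallProd (m+2) x = fallProd m x · (x − m)(x − m − 1)`. -/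
theorem fallProd_two (m : ℕ) (x : ℚ) : fallProd (m + 2) x = fallProd m x * ((x - m) * (x - m - 1)) := by
  rw [show m + 2 = m + 1 + 1 by rfl, fallProd_succ, fallProd_succ]; push_cast; ring

/-- `fallProd (m+2) (x+1) = fallProd m x · (x+1)(x − m)`. -/
theorem fallProd_two_shift (m : ℕ) (x : ℚ) :
    fallProd (m + 2) (x + 1) = fallProd m x * ((x + 1) * (x - m)) := by
  rw [show m + 2 = m + 1 + 1 by rfl, fallProd_succ, fallProd_succ_shift]; push_cast; ring

/-- `fallProd (m+2) (x+2) = fallProd m x · (x+2)(x+1)`. -/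
theorem fallProd_two_shift_two (m : ℕ) (x : ℚ) :
    fallProd (m + 2) (x + 2) = fallProd m x * ((x + 2) * (x + 1)) := by
  rw [show m + 2 = m + 1 + 1 by rfl, show x + 2 = (x + 1) + 1 by ring, fallProd_succ_shift, fallProd_succ_shift]
  ring

/-- The polynomial binomial coefficient `C(x,m) = x(x−1)⋯(x−m+1)/m!` (`= Nat.choose` at naturals `x ≥ m`, `= 0`
at naturals `x < m`; the lane's convention). -/
def bp (m : ℕ) (x : ℚ) : ℚ := fallProd m x / m.factorial

/-! ### The summand and the sum -/

/-- The summand `t(n;p,q;k) = (−1)^k C(n,k) C(p−k,n) C(q−k,n)`. -/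
def tT (n : ℕ) (p q : ℚ) (k : ℕ) : ℚ := (-1) ^ k * ((n.choose k : ℕ) : ℚ) * bp n (p - k) * bp n (q - k)

/-- The inner block `T(n;p,q) = Σ_{k ≤ n} t(n;p,q;k)`. -/
def T (n : ℕ) (p q : ℚ) : ℚ := ∑ k ∈ range (n + 1), tT n p q k

/-- Natural boundary: `t(n;p,q;k) = 0` for `k > n`. -/
theorem tT_eq_zero {n k : ℕ} (h : n + 1 ≤ k) (p q : ℚ) : tT n p q k = 0 := by
  simp [tT, Nat.choose_eq_zero_of_lt (by omega : n < k)]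

/-! ### (M3) and (M4): unit `(−1)^k C(n,k) · fallProd m (p−k) · fallProd m (q−k)`, `n = m+1` -/

/-- The unit of the `(p,q)`-relations at level `n = m+1`. -/
def unitM (m : ℕ) (p q : ℚ) (k : ℕ) : ℚ :=
  (-1) ^ k * (((m + 1).choose k : ℕ) : ℚ) * fallProd m (p - k) * fallProd m (q - k)

/-- `Z = (m+1)!²`. -/
def ZM (m : ℕ) : ℚ := ((m + 1).factorial : ℚ) ^ 2

/-- `Z ≠ 0`. -/
theorem ZM_ne_zero (m : ℕ) : ZM m ≠ 0 := by unfold ZM; positivity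

/-- `Z·t(n;p,q;k) = unit·(p−k−m)(q−k−m)`. -/
theorem ZM_tT_00 (m : ℕ) (p q : ℚ) (k : ℕ) :
    ZM m * tT (m + 1) p q k = unitM m p q k * ((p - k - m) * (q - k - m)) := by
  unfold ZM tT bp unitM
  rw [fallProd_succ, fallProd_succ]
  field_simp

/-- `Z·t(n;p+1,q;k) = unit·(p+1−k)(q−k−m)`. -/
theorem ZM_tT_10 (m : ℕ) (p q : ℚ) (k : ℕ) :
    ZM m * tT (m + 1) (p + 1) q k = unitM m p q k * ((p + 1 - k) * (q - k - m)) := by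
  unfold ZM tT bp unitM
  rw [show p + 1 - (k : ℚ) = (p - k) + 1 by ring, fallProd_succ_shift, fallProd_succ]
  field_simp

/-- `Z·t(n;p,q+1;k) = unit·(p−k−m)(q+1−k)`. -/
theorem ZM_tT_01 (m : ℕ) (p q : ℚ) (k : ℕ) :
    ZM m * tT (m + 1) p (q + 1) k = unitM m p q k * ((p - k - m) * (q + 1 - k)) := by
  unfold ZM tT bp unitM
  rw [show q + 1 - (k : ℚ) = (q - k) + 1 by ring, fallProd_succ_shift, fallProd_succ]
  field_simp

/-- `Z·t(n;p+1,q+1;k) = unit·(p+1−k)(q+1−k)`. -/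
theorem ZM_tT_11 (m : ℕ) (p q : ℚ) (k : ℕ) :
    ZM m * tT (m + 1) (p + 1) (q + 1) k = unitM m p q k * ((p + 1 - k) * (q + 1 - k)) := by
  unfold ZM tT bp unitM
  rw [show p + 1 - (k : ℚ) = (p - k) + 1 by ring, show q + 1 - (k : ℚ) = (q - k) + 1 by ring,
    fallProd_succ_shift, fallProd_succ_shift]
  field_simp

/-- **(M4) termwise** (zero certificate): `(p−q)t(p,q) + (n−p+q)t(p+1,q) − (n+p−q)t(p,q+1) + (p−q)t(p+1,q+1) = 0`. -/
theorem M4_termwise (m : ℕ) (p q : ℚ) (k : ℕ) :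
    (p - q) * tT (m + 1) p q k + (((m : ℚ) + 1) - p + q) * tT (m + 1) (p + 1) q k
      + (-(((m : ℚ) + 1) + p - q)) * tT (m + 1) p (q + 1) k + (p - q) * tT (m + 1) (p + 1) (q + 1) k = 0 := by
  apply mul_left_cancel₀ (ZM_ne_zero m)
  have h00 := ZM_tT_00 m p q k
  have h10 := ZM_tT_10 m p q k
  have h01 := ZM_tT_01 m p q k
  have h11 := ZM_tT_11 m p q k
  rw [mul_zero]
  linear_combination (p - q) * h00 + (((m : ℚ) + 1) - p + q) * h10 + (-(((m : ℚ) + 1) + p - q)) * h01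
    + (p - q) * h11

/-- **(M4)**: `(p−q)·T(n;p,q) + (n−p+q)·T(n;p+1,q) − (n+p−q)·T(n;p,q+1) + (p−q)·T(n;p+1,q+1) = 0` (`n ≥ 1`). -/
theorem T_rel_M4 (n : ℕ) (hn : 1 ≤ n) (p q : ℚ) :
    (p - q) * T n p q + ((n : ℚ) - p + q) * T n (p + 1) q - ((n : ℚ) + p - q) * T n p (q + 1)
      + (p - q) * T n (p + 1) (q + 1) = 0 := by
  obtain ⟨m, rfl⟩ : ∃ m, n = m + 1 := ⟨n - 1, by omega⟩
  have h := telescope₄_eq_zero (p - q) (((m : ℚ) + 1) - p + q) (-(((m : ℚ) + 1) + p - q)) (p - q)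
    (tT (m + 1) p q) (tT (m + 1) (p + 1) q) (tT (m + 1) p (q + 1)) (tT (m + 1) (p + 1) (q + 1))
    (fun _ => 0) (m + 2) (fun k _ => by rw [sub_self]; exact M4_termwise m p q k) rfl rfl
  unfold T
  push_cast
  linear_combination h

/-- The (M3) certificate `G(k) = (−1)^k k(p−q) C(n,k) C(p+1−k,n) C(q+1−k,n)` (`G(0) = 0`). -/
def certM3 (n : ℕ) (p q : ℚ) (k : ℕ) : ℚ :=
  (-1) ^ k * (k : ℚ) * (p - q) * ((n.choose k : ℕ) : ℚ) * bp n (p + 1 - k) * bp n (q + 1 - k)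

/-- `Z·G(k) = unit·k(p−q)(p+1−k)(q+1−k)`. -/
theorem ZM_certM3 (m : ℕ) (p q : ℚ) (k : ℕ) :
    ZM m * certM3 (m + 1) p q k = unitM m p q k * ((k : ℚ) * (p - q) * (p + 1 - k) * (q + 1 - k)) := by
  unfold ZM certM3 bp unitM
  rw [show p + 1 - (k : ℚ) = (p - k) + 1 by ring, show q + 1 - (k : ℚ) = (q - k) + 1 by ring,
    fallProd_succ_shift, fallProd_succ_shift]
  field_simp

/-- `Z·G(k+1) = −unit·(p−q)(n−k)(p−k−m)(q−k−m)`. -/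
theorem ZM_certM3_succ (m : ℕ) (p q : ℚ) (k : ℕ) :
    ZM m * certM3 (m + 1) p q (k + 1) =
      unitM m p q k * (-((p - q) * (((m : ℚ) + 1) - k) * (p - k - m) * (q - k - m))) := by
  have hc := choose_succ_right_cast (m + 1) k
  unfold ZM certM3 bp unitM
  push_cast
  rw [show p + 1 - ((k : ℚ) + 1) = p - k by ring, show q + 1 - ((k : ℚ) + 1) = q - k by ring,
    fallProd_succ, fallProd_succ]
  push_cast at hc
  field_simp
  linear_combination ((-1 : ℚ) ^ k * (p - q) * fallProd m (p - ↑k) * (p - ↑k - ↑m) *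
    (fallProd m (q - ↑k) * (q - ↑k - ↑m))) * (-hc)

/-- **(M3) termwise**: `(p−q)(p+q+2−2n)t(p,q) − (p+1−n)(p−q−n)t(p+1,q) − (q+1−n)(n+p−q)t(p,q+1) = G(k+1) − G(k)`. -/
theorem M3_termwise (m : ℕ) (p q : ℚ) (k : ℕ) :
    (p - q) * (p + q + 2 - 2 * ((m : ℚ) + 1)) * tT (m + 1) p q k
      + (-((p + 1 - ((m : ℚ) + 1)) * (p - q - ((m : ℚ) + 1)))) * tT (m + 1) (p + 1) q k
      + (-((q + 1 - ((m : ℚ) + 1)) * (((m : ℚ) + 1) + p - q))) * tT (m + 1) p (q + 1) k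
      = certM3 (m + 1) p q (k + 1) - certM3 (m + 1) p q k := by
  apply mul_left_cancel₀ (ZM_ne_zero m)
  have h00 := ZM_tT_00 m p q k
  have h10 := ZM_tT_10 m p q k
  have h01 := ZM_tT_01 m p q k
  have hG := ZM_certM3 m p q k
  have hG1 := ZM_certM3_succ m p q k
  rw [mul_sub]
  linear_combination (p - q) * (p + q + 2 - 2 * ((m : ℚ) + 1)) * h00
    + (-((p + 1 - ((m : ℚ) + 1)) * (p - q - ((m : ℚ) + 1)))) * h10
    + (-((q + 1 - ((m : ℚ) + 1)) * (((m : ℚ) + 1) + p - q))) * h01 - hG1 + hG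

/-- **(M3)**: `(p−q)(p+q+2−2n)·T(n;p,q) − (p+1−n)(p−q−n)·T(n;p+1,q) − (q+1−n)(n+p−q)·T(n;p,q+1) = 0` (`n ≥ 1`). -/
theorem T_rel_M3 (n : ℕ) (hn : 1 ≤ n) (p q : ℚ) :
    (p - q) * (p + q + 2 - 2 * n) * T n p q - (p + 1 - n) * (p - q - n) * T n (p + 1) q
      - (q + 1 - n) * ((n : ℚ) + p - q) * T n p (q + 1) = 0 := by
  obtain ⟨m, rfl⟩ : ∃ m, n = m + 1 := ⟨n - 1, by omega⟩
  have htop : certM3 (m + 1) p q (m + 2) = 0 := by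
    simp [certM3]
  have h0 : certM3 (m + 1) p q 0 = 0 := by simp [certM3]
  have h := telescope₃_eq_zero ((p - q) * (p + q + 2 - 2 * ((m : ℚ) + 1)))
    (-((p + 1 - ((m : ℚ) + 1)) * (p - q - ((m : ℚ) + 1)))) (-((q + 1 - ((m : ℚ) + 1)) * (((m : ℚ) + 1) + p - q)))
    (tT (m + 1) p q) (tT (m + 1) (p + 1) q) (tT (m + 1) p (q + 1)) (certM3 (m + 1) p q) (m + 2)
    (fun k _ => M3_termwise m p q k) h0 htop
  unfold T
  push_cast
  linear_combination h

/-! ### (P2): unit `(−1)^k C(n,k) · fallProd m (p−k) · fallProd (m+1) (q−k−1)`, `n = m+2` -/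

/-- The unit of the `p`-recurrence at level `n = m+2`. -/
def unitP (m : ℕ) (p q : ℚ) (k : ℕ) : ℚ :=
  (-1) ^ k * (((m + 2).choose k : ℕ) : ℚ) * fallProd m (p - k) * fallProd (m + 1) (q - k - 1)

/-- `Z = (m+2)!²`. -/
def ZP (m : ℕ) : ℚ := ((m + 2).factorial : ℚ) ^ 2

/-- `Z ≠ 0`. -/
theorem ZP_ne_zero (m : ℕ) : ZP m ≠ 0 := by unfold ZP; positivity

/-- `Z·t(n;p,q;k) = unit·(p−k−m)(p−k−m−1)(q−k)`. -/
theorem ZP_tT_0 (m : ℕ) (p q : ℚ) (k : ℕ) :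
    ZP m * tT (m + 2) p q k = unitP m p q k * ((p - k - m) * (p - k - m - 1) * (q - k)) := by
  unfold ZP tT bp unitP
  rw [fallProd_two, show q - (k : ℚ) = (q - k - 1) + 1 by ring, fallProd_succ_shift]
  field_simp
  ring

/-- `Z·t(n;p+1,q;k) = unit·(p+1−k)(p−k−m)(q−k)`. -/
theorem ZP_tT_1 (m : ℕ) (p q : ℚ) (k : ℕ) :
    ZP m * tT (m + 2) (p + 1) q k = unitP m p q k * ((p + 1 - k) * (p - k - m) * (q - k)) := by
  unfold ZP tT bp unitP
  rw [show p + 1 - (k : ℚ) = (p - k) + 1 by ring, fallProd_two_shift,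
    show q - (k : ℚ) = (q - k - 1) + 1 by ring, fallProd_succ_shift]
  field_simp
  ring

/-- `Z·t(n;p+2,q;k) = unit·(p+2−k)(p+1−k)(q−k)`. -/
theorem ZP_tT_2 (m : ℕ) (p q : ℚ) (k : ℕ) :
    ZP m * tT (m + 2) (p + 2) q k = unitP m p q k * ((p + 2 - k) * (p + 1 - k) * (q - k)) := by
  unfold ZP tT bp unitP
  rw [show p + 2 - (k : ℚ) = (p - k) + 2 by ring, fallProd_two_shift_two,
    show q - (k : ℚ) = (q - k - 1) + 1 by ring, fallProd_succ_shift]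
  field_simp
  ring

/-- The (P2) certificate `G(k) = (−1)^k k(q+1−k) C(n,k) C(p+1−k,n−1) C(q−k,n)` at `n = m+2` (`G(0) = 0`). -/
def certP2 (m : ℕ) (p q : ℚ) (k : ℕ) : ℚ :=
  (-1) ^ k * (k : ℚ) * (q + 1 - k) * (((m + 2).choose k : ℕ) : ℚ) * bp (m + 1) (p + 1 - k) * bp (m + 2) (q - k)

/-- `Z·G(k) = unit·k(q+1−k)(m+2)(p+1−k)(q−k)`. -/
theorem ZP_certP2 (m : ℕ) (p q : ℚ) (k : ℕ) :
    ZP m * certP2 m p q k = unitP m p q k * ((k : ℚ) * (q + 1 - k) * ((m : ℚ) + 2) * (p + 1 - k) * (q - k)) := by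
  unfold ZP certP2 bp unitP
  rw [show p + 1 - (k : ℚ) = (p - k) + 1 by ring, fallProd_succ_shift,
    show q - (k : ℚ) = (q - k - 1) + 1 by ring, fallProd_succ_shift, Nat.factorial_succ (m + 1)]
  push_cast
  field_simp
  ring

/-- `Z·G(k+1) = −unit·(q−k)(n−k)(m+2)(p−k−m)(q−k−m−2)`. -/
theorem ZP_certP2_succ (m : ℕ) (p q : ℚ) (k : ℕ) :
    ZP m * certP2 m p q (k + 1) =
      unitP m p q k * (-((q - k) * (((m : ℚ) + 2) - k) * ((m : ℚ) + 2) * (p - k - m) * (q - k - m - 2))) := by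
  have hk : ((k : ℚ) + 1) ≠ 0 := by positivity
  have hc : (((m + 2).choose (k + 1) : ℕ) : ℚ) = (((m + 2).choose k : ℕ) : ℚ) * (((m : ℚ) + 2) - k) / ((k : ℚ) + 1) := by
    have h := choose_succ_right_cast (m + 2) k
    push_cast at h
    field_simp
    linear_combination h
  unfold ZP certP2 bp unitP
  push_cast
  rw [hc, show p + 1 - ((k : ℚ) + 1) = p - k by ring, show q - ((k : ℚ) + 1) = q - k - 1 by ring,
    fallProd_succ m (p - k), show m + 2 = m + 1 + 1 by rfl, fallProd_succ (m + 1) (q - k - 1),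
    Nat.factorial_succ (m + 1)]
  push_cast
  set F1 := fallProd m (p - k)
  set F2 := fallProd (m + 1) (q - k - 1)
  have hf : (((m + 1).factorial : ℕ) : ℚ) ≠ 0 := by positivity
  field_simp
  ring

/-- **(P2) termwise**: `σ₀ t(p) + σ₁ t(p+1) + σ₂ t(p+2) = G(k+1) − G(k)` at `n = m+2`. -/
theorem P2_termwise (m : ℕ) (p q : ℚ) (k : ℕ) :
    (p + 1 - ((m : ℚ) + 2)) * (((m : ℚ) + 2) + p - q + 1) * tT (m + 2) p q k
      + (((m : ℚ) + 2) ^ 2 + 2 * ((m : ℚ) + 2) * p - 2 * ((m : ℚ) + 2) * q + 3 * ((m : ℚ) + 2) - 2 * p ^ 2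
          + 2 * p * q - 5 * p + 3 * q - 3) * tT (m + 2) (p + 1) q k
      + (p + 2 - ((m : ℚ) + 2)) * (p - q + 1 - ((m : ℚ) + 2)) * tT (m + 2) (p + 2) q k
      = certP2 m p q (k + 1) - certP2 m p q k := by
  apply mul_left_cancel₀ (ZP_ne_zero m)
  have h0 := ZP_tT_0 m p q k
  have h1 := ZP_tT_1 m p q k
  have h2 := ZP_tT_2 m p q k
  have hG := ZP_certP2 m p q k
  have hG1 := ZP_certP2_succ m p q k
  rw [mul_sub]
  linear_combination (p + 1 - ((m : ℚ) + 2)) * (((m : ℚ) + 2) + p - q + 1) * h0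
    + (((m : ℚ) + 2) ^ 2 + 2 * ((m : ℚ) + 2) * p - 2 * ((m : ℚ) + 2) * q + 3 * ((m : ℚ) + 2) - 2 * p ^ 2
        + 2 * p * q - 5 * p + 3 * q - 3) * h1
    + (p + 2 - ((m : ℚ) + 2)) * (p - q + 1 - ((m : ℚ) + 2)) * h2 - hG1 + hG

/-- **(P2)**: the order-2 recurrence of `T(n;p,q)` in `p` (`n ≥ 2`):
`(p+1−n)(n+p−q+1)·T(p) + (n²+2np−2nq+3n−2p²+2pq−5p+3q−3)·T(p+1) + (p+2−n)(p−q+1−n)·T(p+2) = 0`. -/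
theorem T_rel_P2 (n : ℕ) (hn : 2 ≤ n) (p q : ℚ) :
    (p + 1 - n) * ((n : ℚ) + p - q + 1) * T n p q
      + ((n : ℚ) ^ 2 + 2 * n * p - 2 * n * q + 3 * n - 2 * p ^ 2 + 2 * p * q - 5 * p + 3 * q - 3) * T n (p + 1) q
      + (p + 2 - n) * (p - q + 1 - n) * T n (p + 2) q = 0 := by
  obtain ⟨m, rfl⟩ : ∃ m, n = m + 2 := ⟨n - 2, by omega⟩
  have htop : certP2 m p q (m + 3) = 0 := by
    simp [certP2]
  have h0 : certP2 m p q 0 = 0 := by simp [certP2]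
  have h := telescope₃_eq_zero ((p + 1 - ((m : ℚ) + 2)) * (((m : ℚ) + 2) + p - q + 1))
    (((m : ℚ) + 2) ^ 2 + 2 * ((m : ℚ) + 2) * p - 2 * ((m : ℚ) + 2) * q + 3 * ((m : ℚ) + 2) - 2 * p ^ 2
          + 2 * p * q - 5 * p + 3 * q - 3)
    ((p + 2 - ((m : ℚ) + 2)) * (p - q + 1 - ((m : ℚ) + 2)))
    (tT (m + 2) p q) (tT (m + 2) (p + 1) q) (tT (m + 2) (p + 2) q) (certP2 m p q) (m + 3)
    (fun k _ => P2_termwise m p q k) h0 htop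
  unfold T
  push_cast
  linear_combination h

end VIMInner

end Summit.KontsevichZagierPeriods.Zeta5Search.Certificates
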